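import Literature.NumberTheory.ModularSymbols.FullLevelHomologyTwistCycle
import Literature.Algebra.Homology.GroupHomologyPermutationModuleProjector
import HarnessLib

/-!
# Translates `e_{T̃}(g · Y)` of a weighted base class `Y = [γ̃ ⊗ Σ_t c(t)δ_t]` and their image under the up/down dictionary:
# `Σ_t c(t)·{∞, (δ⁻¹ t_s(γ̃, t g⁻¹T̃) δ)∞}`

Topic `Literature/NumberTheory/ModularSymbols`; namespace `Literature.NumberTheory.ModularSymbols.FullLevel`; sequel of
`FullLevelHomologyCosetTransferFormula` (dictionary on a family of coset symbols), `FullLevelHomologyCoeffTwist` (`M_θ`) and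
`GroupHomologyPermutationModuleProjector` (`avgProj`, `toInvariants`).  Definitions with bodies + proved theorems; no named
fact, no `sorry`, no instance, no notation.

For `γ̃ ∈ Γ_T` and a weight `c : T̃ → k` invariant under `t ↦ γ̄⁻¹t` (e.g. constant, or `θ(det t)·a`), the chain
`[γ̃] ⊗ Σ_{t ∈ T̃} c(t) δ_t` is a `1`-cycle of `k[GL₂(ℤ/p)]` (`weightedBaseChain`); its class covers the base coset classes
(`c ≡ a`: `|T̃|·cosetClass[γ̃ ⊗ aδ_{T̃}]`) and their coefficient twists (`c = θ∘det · a`: `|T̃|·M_θ cosetClass[γ̃ ⊗ aδ_{T̃}]`).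
For `g ∈ GL₂(ℤ/p)`, the `T̃`-average of `g · [γ̃ ⊗ Σ c(t)δ_t]` corresponds under the averaging isomorphism to the FAMILY cycle
`Σ_t [γ̃] ⊗ c(t) δ_{(t g⁻¹)T̃}` (`H1quot_avgProj`, `H1quot_H1carrierRep_weightedBaseClass`), whence by the family formula
**`torusInvariantsToCuspidal_toInvariants_translate`**:
  `dictionary(e_{T̃}(g · [γ̃ ⊗ Σ c(t)δ_t])) = Σ_{t ∈ T̃} c(t) · ({∞, (δ⁻¹ t_s(γ̃, (t g⁻¹)T̃) δ)∞} ⊗ 1)`  (any section `s`).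
These are the values `Π_f(Y)(g)` of the spread period map on (twisted) base classes — the input of the kernel analysis
`FullLevelHomologySpreadKernel`.

## References
* K. S. Brown, *Cohomology of Groups* (1982), Ch. III §5–§6, §9 (A)–(B). [Brown1982]
* A. Ash, G. Stevens, Duke Math. J. 53 (1986), §1 (1.2)–(1.4). [AshStevens1986]
-/

noncomputable section

namespace Literature.NumberTheory.ModularSymbols

namespace FullLevel

open scoped MatrixGroups TensorProduct
open CategoryTheory CongruenceSubgroup groupHomology Finsupp Matrix
open Literature.Algebra.Homology
open Literature.NumberTheory.EllipticCurves.ModularForms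

variable (k : Type) [CommRing k] (p M : ℕ) [Fact p.Prime] [Fintype (diagTorus (ZMod p))]

/-! ### `H₁(π)` is blind to the torus action and to averaging -/

omit [Fintype (diagTorus (ZMod p))] in
/-- `H₁(π)(h · z) = H₁(π) z` for `h ∈ T̃` (`π : k[G] → k[G/T̃]`). [cite: Brown1982, Ch. III §6] -/
theorem H1quot_H1carrierRep_of_mem {h : GL (Fin 2) (ZMod p)} (hh : h ∈ diagTorus (ZMod p)) (z : H1carrier k p M) :
    PermutationCoeff.H1quot k (redGL p M) (diagTorus (ZMod p)) (H1carrierRep k p M h z) =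
      PermutationCoeff.H1quot k (redGL p M) (diagTorus (ZMod p)) z := by
  rw [PermutationCoeff.H1quot, H1carrierRep, PermutationCoeff.H1RightRep_apply, ← LinearMap.comp_apply,
    ← ModuleCat.hom_comp, ← groupHomology.map_id_comp,
    PermutationCoeff.rightTranslation_comp_quotientCoeffHom (redGL p M) (diagTorus (ZMod p)) ⟨h, hh⟩]

variable [Invertible (Fintype.card (diagTorus (ZMod p)) : k)]

/-- `H₁(π)(e_{T̃} z) = H₁(π) z`. [cite: Brown1982, Ch. III §9] -/
theorem H1quot_avgProj (z : H1carrier k p M) :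
    PermutationCoeff.H1quot k (redGL p M) (diagTorus (ZMod p)) (PermutationCoeff.avgProj (redGL p M) (diagTorus (ZMod p)) z) =
      PermutationCoeff.H1quot k (redGL p M) (diagTorus (ZMod p)) z := by
  rw [PermutationCoeff.avgProj_apply, map_smul, map_sum,
    Finset.sum_congr rfl (fun t _ => H1quot_H1carrierRep_of_mem k p M t.2 z), Finset.sum_const, Finset.card_univ,
    ← Nat.cast_smul_eq_nsmul k, smul_smul, invOf_mul_self, one_smul]

/-! ### Weighted base chains `[γ̃] ⊗ Σ_t c(t) δ_t` -/

/-- The torus element `γ̄⁻¹ ∈ T̃` of `γ̃ ∈ Γ_T`. [cite: DiamondShurman2005, §1.5] -/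
def redInv (γ : torusLevel p M) : diagTorus (ZMod p) :=
  ⟨(redGL p M γ.1)⁻¹, inv_mem (redGL_mem_diagTorus_of_mem_torusLevel p M γ.2)⟩

omit [Fintype (diagTorus (ZMod p))] [Invertible (Fintype.card (diagTorus (ZMod p)) : k)] in
/-- Unfolding `redInv`. [cite: DiamondShurman2005, §1.5] -/
theorem coe_redInv (γ : torusLevel p M) : ((redInv p M γ : diagTorus (ZMod p)) : GL (Fin 2) (ZMod p)) = (redGL p M γ.1)⁻¹ := rfl

/-- The weighted base coefficient `Σ_{t ∈ T̃} c(t) δ_{1·t} ∈ k[GL₂(ℤ/p)]`. [cite: Brown1982, Ch. III §5] -/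
def weightedBaseCoeff (c : diagTorus (ZMod p) → k) : coeff k p M :=
  ∑ t : diagTorus (ZMod p), single ((1 : GL (Fin 2) (ZMod p)) * t) (c t)

omit [Invertible (Fintype.card (diagTorus (ZMod p)) : k)] in
/-- `ρ(γ̃⁻¹)` fixes the weighted base coefficient when the weight is invariant under `t ↦ γ̄⁻¹t`. [cite: Brown1982, Ch. III §5] -/
theorem coeff_ρ_inv_weightedBaseCoeff (γ : torusLevel p M) (c : diagTorus (ZMod p) → k)
    (hc : ∀ t, c (redInv p M γ * t) = c t) :
    (coeff k p M).ρ γ.1⁻¹ (weightedBaseCoeff k p M c) = weightedBaseCoeff k p M c := by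
  rw [weightedBaseCoeff, map_sum]
  refine Fintype.sum_equiv (Equiv.mulLeft (redInv p M γ)) _ _ fun t => ?_
  rw [Equiv.coe_mulLeft, hc]
  show PermutationCoeff.permRep k (redGL p M) _ γ.1⁻¹ _ = _
  rw [PermutationCoeff.permRep_single, smul_eq_mul, map_inv, Subgroup.coe_mul, coe_redInv, one_mul, one_mul]

/-- The weighted base chain `[γ̃] ⊗ Σ_t c(t) δ_t`. [cite: Brown1982, Ch. III §5] -/
def weightedBaseChain (γ : torusLevel p M) (c : diagTorus (ZMod p) → k) : Gamma0 M →₀ coeff k p M :=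
  single γ.1 (weightedBaseCoeff k p M c)

omit [Invertible (Fintype.card (diagTorus (ZMod p)) : k)] in
/-- The weighted base chain is a cycle (invariant weight). [cite: Brown1982, Ch. III §5] -/
theorem weightedBaseChain_mem_cycles₁ (γ : torusLevel p M) (c : diagTorus (ZMod p) → k)
    (hc : ∀ t, c (redInv p M γ * t) = c t) : weightedBaseChain k p M γ c ∈ cycles₁ (coeff k p M) := by
  rw [weightedBaseChain, single_mem_cycles₁_iff]
  have h := congrArg ((coeff k p M).ρ γ.1) (coeff_ρ_inv_weightedBaseCoeff k p M γ c hc)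
  rw [← Module.End.mul_apply, ← map_mul, mul_inv_cancel, map_one, Module.End.one_apply] at h
  exact h.symm

/-- The weighted base class `[γ̃ ⊗ Σ_t c(t)δ_t]`. [cite: Brown1982, Ch. III §6] -/
def weightedBaseClass (γ : torusLevel p M) (c : diagTorus (ZMod p) → k) (hc : ∀ t, c (redInv p M γ * t) = c t) :
    H1carrier k p M :=
  H1π _ ⟨weightedBaseChain k p M γ c, weightedBaseChain_mem_cycles₁ k p M γ c hc⟩

/-- **Constant weight: `[γ̃ ⊗ Σ_t aδ_t] = |T̃| · cosetClass[γ̃ ⊗ aδ_{T̃}]`.** [cite: Brown1982, Ch. III §6] -/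
theorem weightedBaseClass_const (γ : torusLevel p M) (a : k) :
    weightedBaseClass k p M γ (fun _ => a) (fun _ => rfl) =
      (Fintype.card (diagTorus (ZMod p)) : k) • (cosetClass k p M (baseCycle k p M γ a) : H1carrier k p M) := by
  rw [coe_cosetClass, smul_smul, mul_invOf_self, one_smul, weightedBaseClass]
  congr 1
  apply Subtype.ext
  show weightedBaseChain k p M γ (fun _ => a) = liftCosetChain k p M (baseCycle k p M γ a).1
  rw [weightedBaseChain, baseCycle, liftCosetChain, mapRange.linearMap_apply, mapRange_single, weightedBaseCoeff]
  congr 1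
  rw [show (PermutationCoeff.cosetLiftHom (k := k) (redGL p M) (diagTorus (ZMod p))).hom.toLinearMap (single (baseCoset p) a) =
    (PermutationCoeff.cosetLiftHom (k := k) (redGL p M) (diagTorus (ZMod p))).hom (single (baseCoset p) a) from rfl,
    PermutationCoeff.cosetLiftHom_single, baseCoset_eq, PermutationCoeff.cosetIndicator_coe, Finset.smul_sum]
  refine Finset.sum_congr rfl fun t _ => ?_
  rw [Finsupp.smul_single, smul_eq_mul, mul_one]

omit [Fintype (diagTorus (ZMod p))] [Invertible (Fintype.card (diagTorus (ZMod p)) : k)] in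
/-- The twisted weight `θ(det(1·t))·a` is invariant (`det γ̄⁻¹ = 1`). [cite: DiamondShurman2005, §1.2] -/
theorem twistWeight_invariant (θ : (ZMod p)ˣ →* kˣ) (γ : torusLevel p M) (a : k) (t : diagTorus (ZMod p)) :
    detChar k p θ ((1 : GL (Fin 2) (ZMod p)) * (redInv p M γ * t : diagTorus (ZMod p))) * a =
      detChar k p θ ((1 : GL (Fin 2) (ZMod p)) * t) * a := by
  rw [Subgroup.coe_mul, coe_redInv, one_mul, one_mul, detChar_mul]
  have h := detChar_inv_mul k p θ (redGL p M γ.1)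
  rw [detChar_redGL, mul_one] at h
  rw [h, one_mul]

/-- **Twisted weight: `[γ̃ ⊗ Σ_t θ(det t)aδ_t] = |T̃| · M_θ cosetClass[γ̃ ⊗ aδ_{T̃}]`.** [cite: Brown1982, Ch. III §6] -/
theorem weightedBaseClass_twist (θ : (ZMod p)ˣ →* kˣ) (γ : torusLevel p M) (a : k) :
    weightedBaseClass k p M γ (fun t => detChar k p θ ((1 : GL (Fin 2) (ZMod p)) * t) * a) (twistWeight_invariant k p M θ γ a) =
      (Fintype.card (diagTorus (ZMod p)) : k) • H1coeffTwist k p M θ (cosetClass k p M (baseCycle k p M γ a) : H1carrier k p M) := by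
  rw [← map_smul, ← weightedBaseClass_const, weightedBaseClass, weightedBaseClass, H1coeffTwist_H1π]
  congr 1
  apply Subtype.ext
  rw [coe_mapCycles₁_coeffTwist]
  show weightedBaseChain k p M γ _ = mapRange.linearMap (coeffTwistLin k p M θ) (weightedBaseChain k p M γ fun _ => a)
  unfold weightedBaseChain weightedBaseCoeff
  rw [mapRange.linearMap_apply, mapRange_single, map_sum]
  congr 1
  refine Finset.sum_congr rfl fun t _ => ?_
  rw [coeffTwistLin_single]

/-! ### The translated family and its dictionary image -/

/-- The cosets `y_t = (t g⁻¹)T̃`. [cite: Brown1982, Ch. III §6] -/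
def translateCoset (g : GL (Fin 2) (ZMod p)) (t : diagTorus (ZMod p)) : GL (Fin 2) (ZMod p) ⧸ diagTorus (ZMod p) :=
  (((1 : GL (Fin 2) (ZMod p)) * t * g⁻¹ : GL (Fin 2) (ZMod p)) : GL (Fin 2) (ZMod p) ⧸ diagTorus (ZMod p))

omit [Fintype (diagTorus (ZMod p))] [Invertible (Fintype.card (diagTorus (ZMod p)) : k)] in
/-- `γ̄⁻¹ · y_t = y_{γ̄⁻¹ t}`. [cite: Brown1982, Ch. III §6] -/
theorem redGL_inv_smul_translateCoset (γ : torusLevel p M) (g : GL (Fin 2) (ZMod p)) (t : diagTorus (ZMod p)) :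
    (redGL p M γ.1)⁻¹ • translateCoset p g t = translateCoset p g (redInv p M γ * t) := by
  rw [translateCoset, translateCoset, MulAction.Quotient.smul_coe, smul_eq_mul, Subgroup.coe_mul, coe_redInv, one_mul,
    one_mul, mul_assoc]

omit [Invertible (Fintype.card (diagTorus (ZMod p)) : k)] in
/-- The translated family chain `Σ_t [γ̃] ⊗ c(t) δ_{(t g⁻¹)T̃}` is a cycle (invariant weight). [cite: Brown1982, Ch. III §9 (A)] -/
theorem translateFamily_mem_cycles₁ (γ : torusLevel p M) (g : GL (Fin 2) (ZMod p)) (c : diagTorus (ZMod p) → k)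
    (hc : ∀ t, c (redInv p M γ * t) = c t) :
    familyChain k p M (fun _ : diagTorus (ZMod p) => γ.1) (translateCoset p g) c ∈
      cycles₁ (PermutationCoeff.permRepObj k (redGL p M) (GL (Fin 2) (ZMod p) ⧸ diagTorus (ZMod p))) := by
  rw [familyChain, ← Finsupp.single_finsetSum, single_mem_cycles₁_iff]
  have h : (PermutationCoeff.permRepObj k (redGL p M) (GL (Fin 2) (ZMod p) ⧸ diagTorus (ZMod p))).ρ γ.1⁻¹
      (∑ t : diagTorus (ZMod p), single (translateCoset p g t) (c t)) = ∑ t : diagTorus (ZMod p), single (translateCoset p g t) (c t) := by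
    rw [map_sum]
    refine Fintype.sum_equiv (Equiv.mulLeft (redInv p M γ)) _ _ fun t => ?_
    rw [Equiv.coe_mulLeft, hc]
    show PermutationCoeff.permRep k (redGL p M) _ γ.1⁻¹ _ = _
    rw [PermutationCoeff.permRep_single, map_inv, redGL_inv_smul_translateCoset]
  have h2 := congrArg ((PermutationCoeff.permRepObj k (redGL p M) (GL (Fin 2) (ZMod p) ⧸ diagTorus (ZMod p))).ρ γ.1) h
  rw [← Module.End.mul_apply, ← map_mul, mul_inv_cancel, map_one, Module.End.one_apply] at h2
  exact h2.symm

omit [Invertible (Fintype.card (diagTorus (ZMod p)) : k)] in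
/-- **`H₁(π)(g · [γ̃ ⊗ Σ c(t)δ_t]) = [Σ_t [γ̃] ⊗ c(t)δ_{(tg⁻¹)T̃}]`.** [cite: Brown1982, Ch. III §6] -/
theorem H1quot_H1carrierRep_weightedBaseClass (γ : torusLevel p M) (g : GL (Fin 2) (ZMod p)) (c : diagTorus (ZMod p) → k)
    (hc : ∀ t, c (redInv p M γ * t) = c t) :
    PermutationCoeff.H1quot k (redGL p M) (diagTorus (ZMod p)) (H1carrierRep k p M g (weightedBaseClass k p M γ c hc)) =
      H1π _ ⟨familyChain k p M (fun _ : diagTorus (ZMod p) => γ.1) (translateCoset p g) c,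
        translateFamily_mem_cycles₁ k p M γ g c hc⟩ := by
  rw [weightedBaseClass, H1carrierRep_H1π, PermutationCoeff.H1quot,
    groupHomology.H1π_comp_map_apply (A := coeff k p M)
      (B := PermutationCoeff.permRepObj k (redGL p M) (GL (Fin 2) (ZMod p) ⧸ diagTorus (ZMod p)))]
  congr 1
  apply Subtype.ext
  rw [coe_mapCycles₁, coe_mapCycles₁_rightTranslation]
  show (ModuleCat.Hom.hom (ModuleCat.ofHom ((Finsupp.mapRange.linearMap
      (PermutationCoeff.quotientCoeffHom (k := k) (redGL p M) (diagTorus (ZMod p))).hom.toLinearMap) ∘ₗ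
      Finsupp.lmapDomain _ k (MonoidHom.id (Gamma0 M)))))
      (mapRange.linearMap (PermutationCoeff.rightTranslation (k := k) (redGL p M) g).hom.toLinearMap
        (weightedBaseChain k p M γ c)) = familyChain k p M (fun _ : diagTorus (ZMod p) => γ.1) (translateCoset p g) c
  rw [weightedBaseChain, mapRange.linearMap_apply, mapRange_single, familyChain, ← Finsupp.single_finsetSum]
  simp only [ModuleCat.hom_ofHom, LinearMap.coe_comp, Function.comp_apply, lmapDomain_apply, MonoidHom.coe_id, mapDomain_id,
    mapRange.linearMap_apply, mapRange_single]
  congr 1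
  rw [show (PermutationCoeff.rightTranslation (k := k) (redGL p M) g).hom.toLinearMap (weightedBaseCoeff k p M c) =
      (PermutationCoeff.rightTranslation (k := k) (redGL p M) g).hom (weightedBaseCoeff k p M c) from rfl,
    weightedBaseCoeff, map_sum]
  rw [show (PermutationCoeff.quotientCoeffHom (k := k) (redGL p M) (diagTorus (ZMod p))).hom.toLinearMap
      (∑ x : diagTorus (ZMod p), (PermutationCoeff.rightTranslation (k := k) (redGL p M) g).hom (single ((1 : GL (Fin 2) (ZMod p)) * x) (c x))) =
      (PermutationCoeff.quotientCoeffHom (k := k) (redGL p M) (diagTorus (ZMod p))).hom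
      (∑ x : diagTorus (ZMod p), (PermutationCoeff.rightTranslation (k := k) (redGL p M) g).hom (single ((1 : GL (Fin 2) (ZMod p)) * x) (c x))) from rfl,
    map_sum]
  refine Finset.sum_congr rfl fun t _ => ?_
  rw [PermutationCoeff.rightTranslation_single]
  exact PermutationCoeff.quotientCoeffHom_single (redGL p M) (diagTorus (ZMod p)) _ (c t)

/-- **`e_{T̃}(g · [γ̃ ⊗ Σ c(t)δ_t]) = cosetClass (Σ_t [γ̃] ⊗ c(t)δ_{(tg⁻¹)T̃})`** in the torus invariants.
[cite: Brown1982, Ch. III §6 and §9] -/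
theorem toInvariants_H1carrierRep_weightedBaseClass (γ : torusLevel p M) (g : GL (Fin 2) (ZMod p))
    (c : diagTorus (ZMod p) → k) (hc : ∀ t, c (redInv p M γ * t) = c t) :
    PermutationCoeff.toInvariants (redGL p M) (diagTorus (ZMod p)) (H1carrierRep k p M g (weightedBaseClass k p M γ c hc)) =
      cosetClass k p M ⟨familyChain k p M (fun _ : diagTorus (ZMod p) => γ.1) (translateCoset p g) c,
        translateFamily_mem_cycles₁ k p M γ g c hc⟩ := by
  apply (PermutationCoeff.invariantsEquivQuot (redGL p M) (diagTorus (ZMod p))).injective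
  rw [invariantsEquivQuot_cosetClass, PermutationCoeff.invariantsEquivQuot_apply, PermutationCoeff.coe_toInvariants,
    H1quot_avgProj, H1quot_H1carrierRep_weightedBaseClass]

variable (hpM : Nat.Coprime p M) [NeZero M] [NeZero (p ^ 2 * M)]
  (s : GL (Fin 2) (ZMod p) ⧸ diagTorus (ZMod p) → Gamma0 M) (hs : ∀ y, redGL p M (s y) • baseCoset p = y)

/-- **The dictionary on the averaged translate**:
`dictionary(e_{T̃}(g · [γ̃ ⊗ Σ c(t)δ_t])) = Σ_t c(t)·({∞, (δ⁻¹ t_s(γ̃, (tg⁻¹)T̃) δ)∞} ⊗ 1)` (any section `s`).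
[cite: AshStevens1986, §1 (1.3)–(1.4); Brown1982, Ch. III §9] -/
theorem torusInvariantsToCuspidal_toInvariants_translate (γ : torusLevel p M) (g : GL (Fin 2) (ZMod p))
    (c : diagTorus (ZMod p) → k) (hc : ∀ t, c (redInv p M γ * t) = c t) :
    torusInvariantsToCuspidal k p M hpM
        (PermutationCoeff.toInvariants (redGL p M) (diagTorus (ZMod p)) (H1carrierRep k p M g (weightedBaseClass k p M γ c hc))) =
      ∑ t : diagTorus (ZMod p), c t • Literature.NumberTheory.ModularSymbols.symbol (p ^ 2 * M) k
        (torusLevelEquiv p M hpM (transferFamily p M s hs (fun _ : diagTorus (ZMod p) => γ.1) (translateCoset p g) t) :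
          Gamma0 (p ^ 2 * M)) := by
  rw [toInvariants_H1carrierRep_weightedBaseClass]
  exact torusInvariantsToCuspidal_cosetClass_family k p M s hs hpM _ _ c _

omit [Fintype (diagTorus (ZMod p))] [Invertible (Fintype.card (diagTorus (ZMod p)) : k)] [NeZero M] [NeZero (p ^ 2 * M)] in
/-- The transfer element of the translated family at `t`: `t_s(γ̃, y_t) = s(y_t)⁻¹ γ̃ s(y_{γ̄⁻¹t})`. [cite: Brown1982, Ch. III §9 (A)] -/
theorem coe_transferFamily_translate (γ : torusLevel p M) (g : GL (Fin 2) (ZMod p)) (t : diagTorus (ZMod p)) :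
    (transferFamily p M s hs (fun _ : diagTorus (ZMod p) => γ.1) (translateCoset p g) t : Gamma0 M) =
      (s (translateCoset p g t))⁻¹ * γ.1 * s (translateCoset p g (redInv p M γ * t)) := by
  rw [coe_transferFamily, redGL_inv_smul_translateCoset]

end FullLevel

end Literature.NumberTheory.ModularSymbols
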